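import Mathlib
import Literature.NumberTheory.Sieve.BatemanHornProofs
import Summits.Parity.BatemanHorn.Theorems.IsogenyRedeiPolyMobiusTailStubEventuallyTwoLe
import Summits.Parity.BatemanHorn.Theorems.PolyMobiusTail.Negative.Structure
import Literature.NumberTheory.LFunctions.PolynomialRootMoebiusShortInterval
import Summits.Parity.BatemanHorn.Theorems.IsogenyRedeiPolyMobiusTailStubStripFinOneB

/-!
# Crux `PolyMobiusTail` (stmt-Parity-0870), line `Sketch` (natural form): stub `stub_strip`, case `k = 1` — file C (the raw bound)

The registered stub `stub_strip_fin_one` of the lead's skeleton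
`Summits/Parity/BatemanHorn/Cruxes/PolyMobiusTail/Lines/Sketch.lean` (the natural tail of a ONE-member
Bateman–Horn system between the cut-offs `x^{1-η}` and `x/(log x)^4` sums to `o(x)`) is proved in four
files (`…StubStripFinOne{A,B,C,}.lean`, worker of the line lead prover-line-stmt-Parity-0870-0); the
head theorem of each helper file is a registered auxiliary stub (`stub_core_fin_one`, `stub_U_identity`,
`stub_strip_fin_one_raw_bound`) so that it lands under the gate's stub-match rule.  Inputs from the tree:
Landau's theorem for `Σ μ(n)ρ_g(n)/n` in M-form with rate `(log x)^{-2}`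
(`Literature.NumberTheory.LFunctions.abs_sum_moebius_rootCount_div_le`) and the short-interval mass of
`|μρ_g|` (`…MoebiusRootCount.shortInterval_abs_moebius_mul_rootCount_le`).

This file: the raw bound `stub_strip_fin_one_raw_bound` (registered auxiliary stub: main terms
`X·(C₁/log²y₂ + C₁/log²y₁) + x·5C₁/log⌊y₁⌋`, error terms `2K log x·A(y₁+y₂) + 2A(y₂ log y₂ + y₁ log y₁)`),
the initial segment `n < N₀`, and two small asymptotic lemmas.
-/

open scoped BigOperators
open Filter Finset Polynomial Asymptotics

namespace Summit.Parity.BatemanHorn.Theorems.PolyMobiusTail.NaturalForm.StripFinOne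

open Literature.NumberTheory.Sieve

/-- **Stub `stub_strip_fin_one_raw_bound`: the raw bound for `k = 1`.** With the threshold data, the growth constant `K`, the mean value
constant `A` and the M-form constant `C₁` of `g`, for `4 ≤ y₁ ≤ y₂ ≤ x`:
`|Σ_{N₀≤n≤x} (tail(n,y₁) − tail(n,y₂))| ≤` main terms `+` error terms. [folklore] -/
theorem stub_strip_fin_one_raw_bound :
    ∀ (g : ℤ[X]) {N₀ : ℕ} (hN₀3 : 3 ≤ N₀) (h2 : ∀ n, N₀ ≤ n → 2 ≤ (g.eval (n : ℤ)).toNat) (hmono : ∀ m n : ℕ, N₀ ≤ m → m ≤ n → g.eval (m : ℤ) ≤ g.eval (n : ℤ)) {K : ℕ} (hK : ∀ n : ℕ, 2 ≤ n → Real.log (((g.eval (n : ℤ)).toNat : ℕ) : ℝ) ≤ K * Real.log n) {A : ℝ} (hA0 : 0 ≤ A) (hA : ∀ Y : ℕ, ∑ e ∈ Icc 1 Y, |(ArithmeticFunction.moebius e : ℝ)| * (polyRootCountMod ![g] e : ℝ) ≤ A * Y) {C₁ : ℝ} (hC₁0 : 0 ≤ C₁) (hC₁ : ∀ y : ℝ,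 2 ≤ y → |∑ e ∈ Icc 1 ⌊y⌋₊, (ArithmeticFunction.moebius e : ℝ) * (polyRootCountMod ![g] e : ℝ) / e| ≤ C₁ / Real.log y ^ 2) {x : ℕ} (hx : N₀ ≤ x) {y₁ y₂ : ℝ} (h4 : 4 ≤ y₁) (h12 : y₁ ≤ y₂) (h2x : y₂ ≤ x),
    |∑ n ∈ Icc N₀ x,
      ((∑ e ∈ ((g.eval (n : ℤ)).toNat).divisors, if y₁ < (e : ℝ) then
          (ArithmeticFunction.moebius e : ℝ) * Real.log ((((g.eval (n : ℤ)).toNat : ℕ) : ℝ) / (e : ℝ))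
          else 0)
        - (∑ e ∈ ((g.eval (n : ℤ)).toNat).divisors, if y₂ < (e : ℝ) then
          (ArithmeticFunction.moebius e : ℝ) * Real.log ((((g.eval (n : ℤ)).toNat : ℕ) : ℝ) / (e : ℝ))
          else 0))|
      ≤ 2 * ((K : ℝ) * Real.log x) * (A * y₂) + 2 * ((K : ℝ) * Real.log x) * (A * y₁)
        + ((x : ℝ) * ((K : ℝ) * Real.log x)) * (C₁ / Real.log y₂ ^ 2 + C₁ / Real.log y₁ ^ 2)
        + 2 * (Real.log y₂ * (A * y₂)) + 2 * (Real.log y₁ * (A * y₁))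
        + (x : ℝ) * (5 * C₁ / Real.log (⌊y₁⌋₊ : ℝ)) := by
  intro g N₀ hN₀3 h2 hmono K hK A hA0 hA C₁ hC₁0 hC₁ x hx y₁ y₂ h4 h12 h2x
  -- elementary facts
  have hy₁0 : 0 ≤ y₁ := by linarith
  have hy₂0 : 0 ≤ y₂ := by linarith
  have hy₁1 : 1 ≤ y₁ := by linarith
  have hy₂1 : 1 ≤ y₂ := by linarith
  have hx3 : 3 ≤ x := hN₀3.trans hx
  have hx0 : (0 : ℝ) < x := by exact_mod_cast (by omega : 0 < x)
  have hlogx0 : 0 ≤ Real.log x := Real.log_nonneg (by exact_mod_cast (by omega : 1 ≤ x))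
  have h1 : ∀ n, N₀ ≤ n → 1 ≤ (g.eval (n : ℤ)).toNat := fun n hn => by have := h2 n hn; omega
  have hfl₁ : 2 ≤ ⌊y₁⌋₊ := Nat.le_floor (by push_cast; linarith)
  have hfl₁₂ : ⌊y₁⌋₊ ≤ ⌊y₂⌋₊ := Nat.floor_le_floor h12
  have hfl₁y : (⌊y₁⌋₊ : ℝ) ≤ y₁ := Nat.floor_le hy₁0
  have hfl₂y : (⌊y₂⌋₊ : ℝ) ≤ y₂ := Nat.floor_le hy₂0
  have hcard : ∀ e : ℕ, ((((range e).filter (fun r : ℕ => ((e : ℕ) : ℤ) ∣ g.eval (r : ℤ))).card : ℕ) : ℝ)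
      = (polyRootCountMod ![g] e : ℝ) := by
    intro e
    rw [polyRootCountMod_single]
  rw [stub_U_identity g h1 hy₁0 hy₂0]
  -- the weight
  set W : ℕ → ℝ := fun n => Real.log ((((g.eval (n : ℤ)).toNat : ℕ) : ℝ)) with hW
  have hW0 : ∀ n, N₀ ≤ n → 0 ≤ W n := fun n _ => Real.log_natCast_nonneg _
  have hWmono : ∀ m n, N₀ ≤ m → m ≤ n → n ≤ x → W m ≤ W n := by
    intro m n hm hmn _
    simp only [hW]
    refine Real.log_le_log (by exact_mod_cast (by linarith [h2 m hm])) ?_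
    exact_mod_cast Int.toNat_le_toNat (hmono m n hm hmn)
  have hWx : W x ≤ (K : ℝ) * Real.log x := hK x (by omega)
  have hone0 : ∀ n, N₀ ≤ n → (0 : ℝ) ≤ (fun _ : ℕ => (1 : ℝ)) n := fun _ _ => zero_le_one
  have honemono : ∀ m n, N₀ ≤ m → m ≤ n → n ≤ x →
      (fun _ : ℕ => (1 : ℝ)) m ≤ (fun _ : ℕ => (1 : ℝ)) n := fun _ _ _ _ _ => le_rfl
  have hper : ∀ e n : ℕ, (((e : ℕ) : ℤ) ∣ g.eval (((n + e : ℕ)) : ℤ)) ↔ (((e : ℕ) : ℤ) ∣ g.eval (n : ℤ)) :=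
    fun e n => dvd_eval_periodic g e n
  -- the two cores, at both cut-offs
  have core₁ : ∀ y : ℝ, 1 ≤ y → y ≤ x →
      |(∑ n ∈ Icc N₀ x, W n * ∑ e ∈ Icc 1 ⌊y⌋₊, (ArithmeticFunction.moebius e : ℝ) *
          (if ((e : ℕ) : ℤ) ∣ g.eval (n : ℤ) then 1 else 0))
        - (∑ n ∈ Icc N₀ x, W n) * ∑ e ∈ Icc 1 ⌊y⌋₊, (ArithmeticFunction.moebius e : ℝ) *
          ((polyRootCountMod ![g] e : ℝ) / e)|
      ≤ 2 * ((K : ℝ) * Real.log x) * (A * y) := by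
    intro y hy1 hyx
    have hy0 : 0 ≤ y := by linarith
    have key := stub_core_fin_one W (fun e => (ArithmeticFunction.moebius e : ℝ))
      (fun e n => ((e : ℕ) : ℤ) ∣ g.eval (n : ℤ)) hx ⌊y⌋₊ hW0 hWmono hper
    simp only [hcard] at key
    refine key.trans ?_
    have hS : ∑ e ∈ Icc 1 ⌊y⌋₊, |(ArithmeticFunction.moebius e : ℝ)| * (polyRootCountMod ![g] e : ℝ)
        ≤ A * y := (hA ⌊y⌋₊).trans (mul_le_mul_of_nonneg_left (Nat.floor_le hy0) hA0)
    have hS0 : 0 ≤ ∑ e ∈ Icc 1 ⌊y⌋₊, |(ArithmeticFunction.moebius e : ℝ)| *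
        (polyRootCountMod ![g] e : ℝ) := Finset.sum_nonneg fun e _ => by positivity
    have hWx0 : 0 ≤ W x := hW0 x hx
    have hfin : 2 * W x * (∑ e ∈ Icc 1 ⌊y⌋₊, |(ArithmeticFunction.moebius e : ℝ)| *
        (polyRootCountMod ![g] e : ℝ)) ≤ 2 * ((K : ℝ) * Real.log x) * (A * y) := by
      gcongr
    exact hfin
  have core₀ : ∀ y : ℝ, 1 ≤ y → y ≤ x →
      |(∑ n ∈ Icc N₀ x, (1 : ℝ) * ∑ e ∈ Icc 1 ⌊y⌋₊,
          ((ArithmeticFunction.moebius e : ℝ) * Real.log e) *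
            (if ((e : ℕ) : ℤ) ∣ g.eval (n : ℤ) then 1 else 0))
        - (∑ n ∈ Icc N₀ x, (1 : ℝ)) * ∑ e ∈ Icc 1 ⌊y⌋₊,
          ((ArithmeticFunction.moebius e : ℝ) * Real.log e) * ((polyRootCountMod ![g] e : ℝ) / e)|
      ≤ 2 * (Real.log y * (A * y)) := by
    intro y hy1 hyx
    have hy0 : 0 ≤ y := by linarith
    have key := stub_core_fin_one (fun _ : ℕ => (1 : ℝ))
      (fun e => (ArithmeticFunction.moebius e : ℝ) * Real.log e)
      (fun e n => ((e : ℕ) : ℤ) ∣ g.eval (n : ℤ)) hx ⌊y⌋₊ hone0 honemono hper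
    simp only [hcard] at key
    refine key.trans ?_
    have hS : ∑ e ∈ Icc 1 ⌊y⌋₊, |(ArithmeticFunction.moebius e : ℝ) * Real.log e| *
        (polyRootCountMod ![g] e : ℝ) ≤ Real.log y * (A * y) := by
      calc ∑ e ∈ Icc 1 ⌊y⌋₊, |(ArithmeticFunction.moebius e : ℝ) * Real.log e| *
            (polyRootCountMod ![g] e : ℝ)
          ≤ ∑ e ∈ Icc 1 ⌊y⌋₊, Real.log y * (|(ArithmeticFunction.moebius e : ℝ)| *
            (polyRootCountMod ![g] e : ℝ)) := by
            refine Finset.sum_le_sum fun e he => ?_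
            have he1 : (1 : ℝ) ≤ e := by exact_mod_cast (Finset.mem_Icc.mp he).1
            have hey : (e : ℝ) ≤ y :=
              le_trans (by exact_mod_cast (Finset.mem_Icc.mp he).2) (Nat.floor_le hy0)
            rw [abs_mul, abs_of_nonneg (Real.log_nonneg he1)]
            have hle : Real.log e ≤ Real.log y := Real.log_le_log (by linarith) hey
            have h0 : 0 ≤ |(ArithmeticFunction.moebius e : ℝ)| * (polyRootCountMod ![g] e : ℝ) := by
              positivity
            nlinarith
        _ = Real.log y * ∑ e ∈ Icc 1 ⌊y⌋₊, |(ArithmeticFunction.moebius e : ℝ)| *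
            (polyRootCountMod ![g] e : ℝ) := by rw [Finset.mul_sum]
        _ ≤ Real.log y * (A * y) :=
            mul_le_mul_of_nonneg_left ((hA ⌊y⌋₊).trans
              (mul_le_mul_of_nonneg_left (Nat.floor_le hy0) hA0)) (Real.log_nonneg hy1)
    linarith
  -- the M-form at both cut-offs
  have hV₁ : ∀ y : ℝ, 2 ≤ y →
      |∑ e ∈ Icc 1 ⌊y⌋₊, (ArithmeticFunction.moebius e : ℝ) * ((polyRootCountMod ![g] e : ℝ) / e)|
        ≤ C₁ / Real.log y ^ 2 := by
    intro y hy
    have h := hC₁ y hy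
    simp only [mul_div_assoc] at h
    exact h
  -- the log-weighted difference by Abel summation
  have hV₀ : |(∑ e ∈ Icc 1 ⌊y₂⌋₊, ((ArithmeticFunction.moebius e : ℝ) * Real.log e) *
        ((polyRootCountMod ![g] e : ℝ) / e))
      - (∑ e ∈ Icc 1 ⌊y₁⌋₊, ((ArithmeticFunction.moebius e : ℝ) * Real.log e) *
        ((polyRootCountMod ![g] e : ℝ) / e))| ≤ 5 * C₁ / Real.log (⌊y₁⌋₊ : ℝ) := by
    set a : ℕ → ℝ := fun e => (ArithmeticFunction.moebius e : ℝ) * (polyRootCountMod ![g] e : ℝ) / e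
      with ha
    have hform : ∀ N : ℕ, ∑ e ∈ Icc 1 N, ((ArithmeticFunction.moebius e : ℝ) * Real.log e) *
        ((polyRootCountMod ![g] e : ℝ) / e) = ∑ e ∈ Ioc 0 N, a e * Real.log e := by
      intro N
      rw [show Icc 1 N = Ioc 0 N from rfl]
      refine Finset.sum_congr rfl fun e _ => ?_
      simp only [ha]
      ring
    rw [hform, hform, ← Finset.sum_Ioc_consecutive _ (Nat.zero_le ⌊y₁⌋₊) hfl₁₂, add_sub_cancel_left]
    have ha0 : a 0 = 0 := by simp [ha]
    have hA' : ∀ N : ℕ, 2 ≤ N → |∑ n ∈ Icc 1 N, a n| ≤ C₁ / Real.log N ^ 2 := by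
      intro N hN
      have h := hC₁ N (by exact_mod_cast hN)
      rw [Nat.floor_natCast] at h
      exact h
    exact abs_sum_Ioc_mul_log_le a hC₁0 ha0 hA' hfl₁ hfl₁₂
  -- sizes of `X = Σ W` and `X₀ = #[N₀, x]`
  have hX0 : 0 ≤ ∑ n ∈ Icc N₀ x, W n := Finset.sum_nonneg fun n hn => hW0 n (Finset.mem_Icc.mp hn).1
  have hXle : ∑ n ∈ Icc N₀ x, W n ≤ (x : ℝ) * ((K : ℝ) * Real.log x) := by
    calc ∑ n ∈ Icc N₀ x, W n ≤ ∑ n ∈ Icc N₀ x, W x :=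
          Finset.sum_le_sum fun n hn => hWmono n x (Finset.mem_Icc.mp hn).1 (Finset.mem_Icc.mp hn).2 le_rfl
      _ = ((Icc N₀ x).card : ℝ) * W x := by rw [Finset.sum_const, nsmul_eq_mul]
      _ ≤ (x : ℝ) * ((K : ℝ) * Real.log x) := by
          refine mul_le_mul ?_ hWx (hW0 x hx) (Nat.cast_nonneg x)
          rw [Nat.card_Icc]
          exact_mod_cast (by omega : x + 1 - N₀ ≤ x)
  have hX₀0 : 0 ≤ ∑ n ∈ Icc N₀ x, (1 : ℝ) := Finset.sum_nonneg fun _ _ => zero_le_one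
  have hX₀le : ∑ n ∈ Icc N₀ x, (1 : ℝ) ≤ x := by
    rw [Finset.sum_const, nsmul_eq_mul, mul_one, Nat.card_Icc]
    exact_mod_cast (by omega : x + 1 - N₀ ≤ x)
  -- combine
  have hy₁x : y₁ ≤ x := h12.trans h2x
  have hy₂2 : 2 ≤ y₂ := by linarith
  have hy₁2 : 2 ≤ y₁ := by linarith
  have e1 := core₁ y₂ hy₂1 h2x
  have e2 := core₁ y₁ hy₁1 hy₁x
  have e3 := core₀ y₂ hy₂1 h2x
  have e4 := core₀ y₁ hy₁1 hy₁x
  have m1 := hV₁ y₂ hy₂2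
  have m2 := hV₁ y₁ hy₁2
  have hmain₁ : (∑ n ∈ Icc N₀ x, W n) *
      (|∑ e ∈ Icc 1 ⌊y₂⌋₊, (ArithmeticFunction.moebius e : ℝ) * ((polyRootCountMod ![g] e : ℝ) / e)|
        + |∑ e ∈ Icc 1 ⌊y₁⌋₊, (ArithmeticFunction.moebius e : ℝ) * ((polyRootCountMod ![g] e : ℝ) / e)|)
      ≤ ((x : ℝ) * ((K : ℝ) * Real.log x)) * (C₁ / Real.log y₂ ^ 2 + C₁ / Real.log y₁ ^ 2) :=
    mul_le_mul hXle (add_le_add m1 m2) (by positivity) (by positivity)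
  have hmain₀ : (∑ n ∈ Icc N₀ x, (1 : ℝ)) *
      |(∑ e ∈ Icc 1 ⌊y₂⌋₊, ((ArithmeticFunction.moebius e : ℝ) * Real.log e) *
          ((polyRootCountMod ![g] e : ℝ) / e))
        - (∑ e ∈ Icc 1 ⌊y₁⌋₊, ((ArithmeticFunction.moebius e : ℝ) * Real.log e) *
          ((polyRootCountMod ![g] e : ℝ) / e))|
      ≤ (x : ℝ) * (5 * C₁ / Real.log (⌊y₁⌋₊ : ℝ)) := by
    refine mul_le_mul hX₀le hV₀ (abs_nonneg _) (Nat.cast_nonneg x)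
  refine (abs_combo_le _ _
    (∑ e ∈ Icc 1 ⌊y₂⌋₊, (ArithmeticFunction.moebius e : ℝ) * ((polyRootCountMod ![g] e : ℝ) / e))
    (∑ e ∈ Icc 1 ⌊y₁⌋₊, (ArithmeticFunction.moebius e : ℝ) * ((polyRootCountMod ![g] e : ℝ) / e))
    (∑ n ∈ Icc N₀ x, W n) _ _
    (∑ e ∈ Icc 1 ⌊y₂⌋₊, ((ArithmeticFunction.moebius e : ℝ) * Real.log e) *
      ((polyRootCountMod ![g] e : ℝ) / e))
    (∑ e ∈ Icc 1 ⌊y₁⌋₊, ((ArithmeticFunction.moebius e : ℝ) * Real.log e) *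
      ((polyRootCountMod ![g] e : ℝ) / e))
    (∑ n ∈ Icc N₀ x, (1 : ℝ)) hX0 hX₀0).trans ?_
  linarith


/-- The finitely many initial `n < N₀` contribute a bounded amount, uniformly in the cut-offs. [folklore] -/
theorem initial_fin_one (g : ℤ[X]) (N₀ x : ℕ) (y₁ y₂ : ℝ) :
    |∑ n ∈ (Icc 1 x).filter (fun n => n < N₀),
      ((∑ e ∈ ((g.eval (n : ℤ)).toNat).divisors, if y₁ < (e : ℝ) then
          (ArithmeticFunction.moebius e : ℝ) * Real.log ((((g.eval (n : ℤ)).toNat : ℕ) : ℝ) / (e : ℝ))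
          else 0)
        - (∑ e ∈ ((g.eval (n : ℤ)).toNat).divisors, if y₂ < (e : ℝ) then
          (ArithmeticFunction.moebius e : ℝ) * Real.log ((((g.eval (n : ℤ)).toNat : ℕ) : ℝ) / (e : ℝ))
          else 0))|
      ≤ ∑ n ∈ range N₀, 2 * ∑ e ∈ ((g.eval (n : ℤ)).toNat).divisors,
          |(ArithmeticFunction.moebius e : ℝ) * Real.log ((((g.eval (n : ℤ)).toNat : ℕ) : ℝ) / (e : ℝ))| := by
  have htail : ∀ (n : ℕ) (y : ℝ),
      |∑ e ∈ ((g.eval (n : ℤ)).toNat).divisors, (if y < (e : ℝ) then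
          (ArithmeticFunction.moebius e : ℝ) * Real.log ((((g.eval (n : ℤ)).toNat : ℕ) : ℝ) / (e : ℝ))
          else 0)|
        ≤ ∑ e ∈ ((g.eval (n : ℤ)).toNat).divisors,
          |(ArithmeticFunction.moebius e : ℝ) * Real.log ((((g.eval (n : ℤ)).toNat : ℕ) : ℝ) / (e : ℝ))| := by
    intro n y
    refine (Finset.abs_sum_le_sum_abs _ _).trans (Finset.sum_le_sum fun e _ => ?_)
    split_ifs
    · exact le_rfl
    · rw [abs_zero]; exact abs_nonneg _
  calc _ ≤ ∑ n ∈ (Icc 1 x).filter (fun n => n < N₀),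
        |(∑ e ∈ ((g.eval (n : ℤ)).toNat).divisors, (if y₁ < (e : ℝ) then
          (ArithmeticFunction.moebius e : ℝ) * Real.log ((((g.eval (n : ℤ)).toNat : ℕ) : ℝ) / (e : ℝ))
          else 0))
        - (∑ e ∈ ((g.eval (n : ℤ)).toNat).divisors, (if y₂ < (e : ℝ) then
          (ArithmeticFunction.moebius e : ℝ) * Real.log ((((g.eval (n : ℤ)).toNat : ℕ) : ℝ) / (e : ℝ))
          else 0))| := Finset.abs_sum_le_sum_abs _ _
    _ ≤ ∑ n ∈ (Icc 1 x).filter (fun n => n < N₀), 2 * ∑ e ∈ ((g.eval (n : ℤ)).toNat).divisors,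
          |(ArithmeticFunction.moebius e : ℝ) * Real.log ((((g.eval (n : ℤ)).toNat : ℕ) : ℝ) / (e : ℝ))| := by
        refine Finset.sum_le_sum fun n _ => ?_
        have h1 := htail n y₁
        have h2 := htail n y₂
        have h := abs_sub _ _ |>.trans (add_le_add h1 h2)
        linarith
    _ ≤ ∑ n ∈ range N₀, 2 * ∑ e ∈ ((g.eval (n : ℤ)).toNat).divisors,
          |(ArithmeticFunction.moebius e : ℝ) * Real.log ((((g.eval (n : ℤ)).toNat : ℕ) : ℝ) / (e : ℝ))| :=
        Finset.sum_le_sum_of_subset_of_nonneg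
          (fun n hn => mem_range.mpr (Finset.mem_filter.mp hn).2)
          fun n _ _ => mul_nonneg zero_le_two (Finset.sum_nonneg fun e _ => abs_nonneg _)

/-- `B + C · x/log x = o(x)` along `ℕ`. [folklore] -/
theorem isLittleO_const_add_mul_div_log (B C : ℝ) :
    (fun x : ℕ => B + C * ((x : ℝ) / Real.log x)) =o[atTop] (fun x : ℕ => (x : ℝ)) := by
  have hreal : (fun t : ℝ => B + C * (t / Real.log t)) =o[atTop] (fun t : ℝ => t) := by
    refine IsLittleO.add (isLittleO_const_id_atTop B) (IsLittleO.const_mul_left ?_ C)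
    have h1 : (fun t : ℝ => (Real.log t)⁻¹) =o[atTop] (fun _ => (1 : ℝ)) :=
      (isLittleO_one_iff ℝ).mpr Real.tendsto_log_atTop.inv_tendsto_atTop
    have h2 : (fun t : ℝ => t) =O[atTop] (fun t : ℝ => t) := isBigO_refl _ _
    refine (h2.mul_isLittleO h1).congr' ?_ ?_
    · exact Eventually.of_forall fun t => by simp [div_eq_mul_inv]
    · exact Eventually.of_forall fun t => by simp
  exact hreal.comp_tendsto tendsto_natCast_atTop_atTop

/-- Eventually along `ℕ`: `(log x)^4 ≤ x^s` for `s > 0`. [folklore] -/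
theorem eventually_log_pow_four_le_rpow {s : ℝ} (hs : 0 < s) :
    ∀ᶠ x : ℕ in atTop, Real.log x ^ 4 ≤ (x : ℝ) ^ s := by
  have h := (isLittleO_log_rpow_rpow_atTop ((4 : ℕ) : ℝ) hs).eventuallyLE
  have h' : ∀ᶠ t : ℝ in atTop, Real.log t ^ 4 ≤ t ^ s := by
    filter_upwards [h, eventually_ge_atTop (1 : ℝ)] with t ht ht1
    rw [Real.rpow_natCast, Real.norm_eq_abs, Real.norm_eq_abs,
      abs_of_nonneg (pow_nonneg (Real.log_nonneg ht1) 4),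
      abs_of_nonneg (Real.rpow_nonneg (by linarith) s)] at ht
    exact ht
  exact tendsto_natCast_atTop_atTop.eventually h'

end Summit.Parity.BatemanHorn.Theorems.PolyMobiusTail.NaturalForm.StripFinOne
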